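import Mathlib
import Summits.QuantumFields.YangMills.Theorems.RationalShortRootRigidityEvenLift
import Summits.QuantumFields.YangMills.Theorems.RationalShortRootRigidityAlternationCore

/-!
# `RationalShortRootRigidity` — Step 4 (`stub_alternation`) assembly, part II: the shell picture `N₀(p) = E(p², q)`

Part of the ASSEMBLY of Step 4 of the paper proof of crux `stmt-QuantumFields-23124`
(`F4SubCurvatureDoor.RationalShortRootRigidity`, LINE g15-A of planner ym-idea-3; birth skeleton
HOME l15/RationalShortRootRigidity-birth.lean, stub `stub_alternation`; plan HOME l15/STUB-PLAN-Alternation.md §0/§2/§3).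

The substitution `Ψ : ℝ[X, q₁, q₂, q₃] → ℝ[p₀, p₁, p₂, p₃]`, `X ↦ Σᵢ pᵢ²`, `qᵢ ↦ pᵢ` (`i = 1,2,3`), written inline as
`MvPolynomial.bind₁ (fun i => if i = 0 then Σ_j X_j² else X_i)`.  Facts proved here (all generic, def-free):

* `eval_shell` — `Ψ(F)(p) = F(p², q)`;
* `exists_shell_of_even` — a polynomial even in `p₀` is `Ψ(E)` for some `E` (from the tree lemma `evenInX0Lift`, p669266,
  composed with the automorphism `u ↦ X − |q|²`);
* `shell_injective` — `Ψ(F) = 0 ⇒ F = 0` (each fibre polynomial `X ↦ F(X, q)` vanishes on `[|q|², ∞)`);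
* `isHomogeneous_shell_weightedComponent` / `homogeneousComponent_shell` — `Ψ` maps the `(2,1,1,1)`-weighted homogeneous
  components of `F` to the homogeneous components of `Ψ(F)`;
* `weight_le_totalDegree_shell` — BUDGET TRANSFER: every monomial `X^a q^m` of `F` has `2a + |m| ≤ totalDegree Ψ(F)`.

Mathlib + the tree lemmas `evenInX0Lift`, `Alternation.eval_fibre` (part I); THEOREMS ONLY; no named facts; no `sorry`; default heartbeats.  Nothing about the crux
23124, the route's rung or the Yang–Mills mass gap is proved here.  Free-hands width seat `ym-line-sfw-p2-w4` g18,
`--supports stmt-QuantumFields-23124`.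
-/

set_option autoImplicit false

namespace Summit.QuantumFields.YangMills.Theorems.RationalShortRootRigidity.Alternation

open scoped BigOperators Polynomial

/-! ### 1. Evaluation of the shell substitution -/

/-- `Ψ(F)(p) = F(Σᵢ pᵢ², p₁, p₂, p₃)`. [folklore] -/
theorem eval_shell (F : MvPolynomial (Fin 4) ℝ) (p : Fin 4 → ℝ) :
    MvPolynomial.eval p (MvPolynomial.bind₁
      (fun i : Fin 4 => if i = 0 then ∑ j : Fin 4, (MvPolynomial.X j : MvPolynomial (Fin 4) ℝ) ^ 2
        else MvPolynomial.X i) F) =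
      MvPolynomial.eval (Fin.cons (∑ j : Fin 4, p j ^ 2) (Fin.tail p) : Fin 4 → ℝ) F := by
  rw [MvPolynomial.eval, MvPolynomial.eval₂Hom_bind₁]
  show MvPolynomial.eval (fun i => MvPolynomial.eval p
    (if i = 0 then ∑ j : Fin 4, (MvPolynomial.X j : MvPolynomial (Fin 4) ℝ) ^ 2 else MvPolynomial.X i)) F = _
  have h : (fun i => MvPolynomial.eval p
      (if i = 0 then ∑ j : Fin 4, (MvPolynomial.X j : MvPolynomial (Fin 4) ℝ) ^ 2 else MvPolynomial.X i)) =
      (Fin.cons (∑ j : Fin 4, p j ^ 2) (Fin.tail p) : Fin 4 → ℝ) := by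
    funext i
    refine Fin.cases ?_ (fun j => ?_) i
    · simp only [↓reduceIte, map_sum, map_pow, MvPolynomial.eval_X, Fin.cons_zero]
    · simp only [Fin.succ_ne_zero, ↓reduceIte, MvPolynomial.eval_X, Fin.cons_succ, Fin.tail]
  rw [h]

/-! ### 2. Existence of the shell form for an even numerator -/

/-- A polynomial even in `p₀` (as a function) is `Ψ(E)` for some `E ∈ ℝ[X, q]`: `N(p) = E(p², q)`. [folklore] -/
theorem exists_shell_of_even (N : MvPolynomial (Fin 4) ℝ)
    (hN : ∀ p : Fin 4 → ℝ, MvPolynomial.eval (fun i => if i = 0 then -p 0 else p i) N = MvPolynomial.eval p N) :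
    ∃ E : MvPolynomial (Fin 4) ℝ, N = MvPolynomial.bind₁
      (fun i : Fin 4 => if i = 0 then ∑ j : Fin 4, (MvPolynomial.X j : MvPolynomial (Fin 4) ℝ) ^ 2
        else MvPolynomial.X i) E := by
  obtain ⟨M, hM⟩ := evenInX0Lift N hN
  -- `E := M(X − |q|², q)`
  refine ⟨MvPolynomial.bind₁ (fun i : Fin 4 => if i = 0 then
    (MvPolynomial.X 0 : MvPolynomial (Fin 4) ℝ) - ∑ j : Fin 3, MvPolynomial.X (Fin.succ j) ^ 2
    else MvPolynomial.X i) M, ?_⟩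
  rw [MvPolynomial.bind₁_bind₁, hM, MvPolynomial.aeval_eq_bind₁]
  have h : (fun i : Fin 4 => if i = 0 then (MvPolynomial.X 0 : MvPolynomial (Fin 4) ℝ) ^ 2 else MvPolynomial.X i) =
      fun i : Fin 4 => MvPolynomial.bind₁
        (fun i : Fin 4 => if i = 0 then ∑ j : Fin 4, (MvPolynomial.X j : MvPolynomial (Fin 4) ℝ) ^ 2
          else MvPolynomial.X i)
        (if i = 0 then (MvPolynomial.X 0 : MvPolynomial (Fin 4) ℝ) - ∑ j : Fin 3, MvPolynomial.X (Fin.succ j) ^ 2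
          else MvPolynomial.X i) := by
    funext i
    refine Fin.cases ?_ (fun j => ?_) i
    · simp only [↓reduceIte, map_sub, map_sum, map_pow, MvPolynomial.bind₁_X_right, Fin.succ_ne_zero]
      rw [Fin.sum_univ_succ (f := fun j : Fin 4 => (MvPolynomial.X j : MvPolynomial (Fin 4) ℝ) ^ 2)]
      ring
    · simp only [Fin.succ_ne_zero, ↓reduceIte, MvPolynomial.bind₁_X_right]
  rw [h]

/-! ### 3. Injectivity of the shell substitution -/

/-- `Ψ` is injective: if `F(p², q) = 0` for all real `p` then `F = 0` (each fibre `X ↦ F(X, q)` vanishes on the half-line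
`X ≥ |q|²`). [folklore] -/
theorem shell_injective (F : MvPolynomial (Fin 4) ℝ)
    (hF : MvPolynomial.bind₁
      (fun i : Fin 4 => if i = 0 then ∑ j : Fin 4, (MvPolynomial.X j : MvPolynomial (Fin 4) ℝ) ^ 2
        else MvPolynomial.X i) F = 0) :
    F = 0 := by
  -- every fibre polynomial vanishes on `[|q|², ∞)`, hence is zero
  have hfib : ∀ q : Fin 3 → ℝ, Polynomial.map (MvPolynomial.eval q) (MvPolynomial.finSuccEquiv ℝ 3 F) = 0 := by
    intro q
    apply Polynomial.eq_zero_of_infinite_isRoot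
    refine Set.Infinite.mono (s := Set.Ici (∑ j : Fin 3, q j ^ 2)) ?_ (Set.Ici_infinite _)
    intro x hx
    rw [Set.mem_Ici] at hx
    rw [Set.mem_setOf_eq, Polynomial.IsRoot.def, eval_fibre]
    -- the point `p = (√(x − |q|²), q)` has `p² = x`
    set p : Fin 4 → ℝ := Fin.cons (Real.sqrt (x - ∑ j : Fin 3, q j ^ 2)) q with hp
    have h := congrArg (MvPolynomial.eval p) hF
    rw [map_zero, eval_shell] at h
    have hsq : ∑ j : Fin 4, p j ^ 2 = x := by
      rw [Fin.sum_univ_succ, hp]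
      simp only [Fin.cons_zero, Fin.cons_succ]
      rw [Real.sq_sqrt (by linarith)]
      ring
    have htail : Fin.tail p = q := by
      rw [hp, Fin.tail_cons]
    rwa [hsq, htail] at h
  apply MvPolynomial.funext
  intro y
  rw [map_zero, ← Fin.cons_self_tail y, ← eval_fibre, hfib, Polynomial.eval_zero]

/-! ### 4. The `(2,1,1,1)`-grading of the shell picture -/

/-- The weight `(2,1,1,1)` of a monomial `X^{m₀} q^{m'}` is `2m₀ + |m'|`. [folklore] -/
theorem weight_two (m : Fin 4 →₀ ℕ) :
    Finsupp.weight (fun i : Fin 4 => if i = 0 then (2 : ℕ) else 1) m = 2 * m 0 + ∑ i : Fin 3, m (Fin.succ i) := by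
  rw [Finsupp.weight_apply, Finsupp.sum_fintype _ _ (fun i => by simp)]
  rw [Fin.sum_univ_succ]
  simp only [↓reduceIte, smul_eq_mul, Fin.succ_ne_zero, mul_one]
  ring

/-- `Σⱼ Xⱼ²` is homogeneous of degree `2`. [folklore] -/
theorem isHomogeneous_sumSq :
    (∑ j : Fin 4, (MvPolynomial.X j : MvPolynomial (Fin 4) ℝ) ^ 2).IsHomogeneous 2 := by
  refine MvPolynomial.IsHomogeneous.sum _ _ _ fun j _ => ?_
  exact MvPolynomial.isHomogeneous_X_pow j 2

/-- `Ψ` maps a `(2,1,1,1)`-weighted-homogeneous polynomial of weight `d` to a homogeneous polynomial of degree `d`.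
[folklore] -/
theorem isHomogeneous_shell_of_isWeightedHomogeneous (F : MvPolynomial (Fin 4) ℝ) (d : ℕ)
    (hF : MvPolynomial.IsWeightedHomogeneous (fun i : Fin 4 => if i = 0 then (2 : ℕ) else 1) F d) :
    (MvPolynomial.bind₁
      (fun i : Fin 4 => if i = 0 then ∑ j : Fin 4, (MvPolynomial.X j : MvPolynomial (Fin 4) ℝ) ^ 2
        else MvPolynomial.X i) F).IsHomogeneous d := by
  classical
  conv => arg 1; rw [F.as_sum]
  rw [map_sum]
  refine MvPolynomial.IsHomogeneous.sum _ _ _ fun m hm => ?_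
  have hw : 2 * m 0 + ∑ i : Fin 3, m (Fin.succ i) = d := by
    rw [← weight_two]
    exact hF (MvPolynomial.mem_support_iff.1 hm)
  rw [MvPolynomial.bind₁_monomial]
  have hsub : ∏ i ∈ m.support, (if i = 0 then ∑ j : Fin 4, (MvPolynomial.X j : MvPolynomial (Fin 4) ℝ) ^ 2
      else MvPolynomial.X i) ^ m i =
      ∏ i, (if i = 0 then ∑ j : Fin 4, (MvPolynomial.X j : MvPolynomial (Fin 4) ℝ) ^ 2 else MvPolynomial.X i) ^ m i := by
    refine Finset.prod_subset (Finset.subset_univ _) fun i _ hi => ?_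
    rw [Finsupp.notMem_support_iff.1 hi, pow_zero]
  rw [hsub, ← zero_add d]
  refine MvPolynomial.IsHomogeneous.mul (MvPolynomial.isHomogeneous_C _ _) ?_
  rw [← hw]
  have hdeg : 2 * m 0 + ∑ i : Fin 3, m (Fin.succ i) =
      ∑ i : Fin 4, (if i = 0 then 2 else 1) * m i := by
    rw [Fin.sum_univ_succ (f := fun i : Fin 4 => (if i = 0 then 2 else 1) * m i)]
    simp only [↓reduceIte, Fin.succ_ne_zero, one_mul]
  rw [hdeg]
  refine MvPolynomial.IsHomogeneous.prod _ _ _ fun i _ => ?_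
  split_ifs with hi
  · exact isHomogeneous_sumSq.pow (m i)
  · exact (MvPolynomial.isHomogeneous_X ℝ i).pow (m i)

/-- A polynomial is the FINITE sum of its `(2,1,1,1)`-weighted components of weight `≤ 2·totalDegree`. [folklore] -/
theorem sum_weightedComponent_two (F : MvPolynomial (Fin 4) ℝ) :
    F = ∑ d ∈ Finset.range (2 * F.totalDegree + 1),
      MvPolynomial.weightedHomogeneousComponent (fun i : Fin 4 => if i = 0 then (2 : ℕ) else 1) d F := by
  classical
  conv_lhs => rw [← MvPolynomial.sum_weightedHomogeneousComponent (fun i : Fin 4 => if i = 0 then (2 : ℕ) else 1) F]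
  refine finsum_eq_sum_of_support_subset _ fun d hd => ?_
  rw [Function.mem_support] at hd
  rw [Finset.coe_range, Set.mem_Iio]
  by_contra hlt
  apply hd
  apply MvPolynomial.weightedHomogeneousComponent_eq_zero'
  intro m hm
  have h1 : Finsupp.weight (fun i : Fin 4 => if i = 0 then (2 : ℕ) else 1) m ≤ 2 * F.totalDegree := by
    have hle := MvPolynomial.le_totalDegree hm
    rw [Finsupp.sum_fintype _ _ (fun _ => rfl), Fin.sum_univ_succ] at hle
    rw [weight_two]
    omega
  omega

/-- The homogeneous components of `Ψ(F)` are the `Ψ`-images of the `(2,1,1,1)`-weighted components of `F`. [folklore] -/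
theorem homogeneousComponent_shell (F : MvPolynomial (Fin 4) ℝ) (d : ℕ) :
    MvPolynomial.homogeneousComponent d (MvPolynomial.bind₁
      (fun i : Fin 4 => if i = 0 then ∑ j : Fin 4, (MvPolynomial.X j : MvPolynomial (Fin 4) ℝ) ^ 2
        else MvPolynomial.X i) F) =
      MvPolynomial.bind₁
        (fun i : Fin 4 => if i = 0 then ∑ j : Fin 4, (MvPolynomial.X j : MvPolynomial (Fin 4) ℝ) ^ 2
          else MvPolynomial.X i)
        (MvPolynomial.weightedHomogeneousComponent (fun i : Fin 4 => if i = 0 then (2 : ℕ) else 1) d F) := by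
  classical
  conv_lhs => rw [sum_weightedComponent_two F]
  rw [map_sum, map_sum]
  have hterm : ∀ d' : ℕ, MvPolynomial.homogeneousComponent d (MvPolynomial.bind₁
      (fun i : Fin 4 => if i = 0 then ∑ j : Fin 4, (MvPolynomial.X j : MvPolynomial (Fin 4) ℝ) ^ 2
        else MvPolynomial.X i)
      (MvPolynomial.weightedHomogeneousComponent (fun i : Fin 4 => if i = 0 then (2 : ℕ) else 1) d' F)) =
      if d = d' then MvPolynomial.bind₁
        (fun i : Fin 4 => if i = 0 then ∑ j : Fin 4, (MvPolynomial.X j : MvPolynomial (Fin 4) ℝ) ^ 2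
          else MvPolynomial.X i)
        (MvPolynomial.weightedHomogeneousComponent (fun i : Fin 4 => if i = 0 then (2 : ℕ) else 1) d' F) else 0 := by
    intro d'
    exact MvPolynomial.homogeneousComponent_of_mem
      ((MvPolynomial.mem_homogeneousSubmodule d' _).2
        (isHomogeneous_shell_of_isWeightedHomogeneous _ d'
          (MvPolynomial.weightedHomogeneousComponent_isWeightedHomogeneous d' F)))
  simp_rw [hterm]
  rw [Finset.sum_ite_eq]
  split_ifs with h
  · rfl
  · -- `d` beyond the range: the weighted component vanishes
    have hzero : MvPolynomial.weightedHomogeneousComponent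
        (fun i : Fin 4 => if i = 0 then (2 : ℕ) else 1) d F = 0 := by
      apply MvPolynomial.weightedHomogeneousComponent_eq_zero'
      intro m hm
      have h1 : Finsupp.weight (fun i : Fin 4 => if i = 0 then (2 : ℕ) else 1) m ≤ 2 * F.totalDegree := by
        have hle := MvPolynomial.le_totalDegree hm
        rw [Finsupp.sum_fintype _ _ (fun _ => rfl), Fin.sum_univ_succ] at hle
        rw [weight_two]
        omega
      rw [Finset.mem_range] at h
      omega
    rw [hzero, map_zero]

/-- BUDGET TRANSFER: every monomial `X^a q^m` of `F` has weight `2a + |m| ≤ totalDegree Ψ(F)` (no cancellation can lower the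
degree, because `Ψ` is injective and graded). [folklore] -/
theorem weight_le_totalDegree_shell (F : MvPolynomial (Fin 4) ℝ) (m : Fin 4 →₀ ℕ) (hm : m ∈ F.support) :
    2 * m 0 + ∑ i : Fin 3, m (Fin.succ i) ≤ (MvPolynomial.bind₁
      (fun i : Fin 4 => if i = 0 then ∑ j : Fin 4, (MvPolynomial.X j : MvPolynomial (Fin 4) ℝ) ^ 2
        else MvPolynomial.X i) F).totalDegree := by
  classical
  by_contra hlt
  push Not at hlt
  set W : ℕ := 2 * m 0 + ∑ i : Fin 3, m (Fin.succ i) with hW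
  -- the weight-`W` component of `F` is non-zero (it contains `m`) ...
  have hne : MvPolynomial.weightedHomogeneousComponent (fun i : Fin 4 => if i = 0 then (2 : ℕ) else 1) W F ≠ 0 := by
    intro h0
    have hc := congrArg (MvPolynomial.coeff m) h0
    rw [MvPolynomial.coeff_weightedHomogeneousComponent, weight_two, if_pos hW.symm, MvPolynomial.coeff_zero] at hc
    exact (MvPolynomial.mem_support_iff.1 hm) hc
  -- ... but its `Ψ`-image is the (vanishing) homogeneous component of degree `W > totalDegree Ψ(F)`
  apply hne
  apply shell_injective
  rw [← homogeneousComponent_shell]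
  exact MvPolynomial.homogeneousComponent_eq_zero _ _ hlt

end Summit.QuantumFields.YangMills.Theorems.RationalShortRootRigidity.Alternation
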